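import Summits.HubbardSuperconductivity.HubbardSuperconductivity.Theorems.DeformationLadderLadderThesisRigidityReduction
import Literature.MathematicalPhysics.QuantumLattice.BdGBondHamiltonian
import Literature.MathematicalPhysics.QuantumLattice.PairCorrelationsProofs
import Literature.MathematicalPhysics.QuantumLattice.HubbardGaugeBound

/-!
# Route `DeformationLadder`, crux `LowEnergyRigidity` (stmt-HubbardSuperconductivity-1892):
# charge twists of the Hubbard torus — the pair-momentum sum rule (Parseval over the twists)

Support file (`--supports stmt-HubbardSuperconductivity-1892`), second half of the TWIST CEILING
(`TwistGap.TgTwistCeiling`). Conjugating the `d`-wave pair field `Δ_d = Σ_x P_x` by the charge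
twist `W_J = phaseGauge (z ↦ e^{2πi J z₁/L})`, `J ∈ ℤ/L`, multiplies the bond pair
`c_{x↑}c_{x+e,↓} − c_{x↓}c_{x+e,↑}` by the phase `e^{-2πi J (2x₁+e₁)/L}` (`twist_conj_pairField`):
the twisted pair field is the pair field at pair momentum `(4πJ/L, 0)`. Summing the twisted pair
weights over ALL `J ∈ ℤ/L`, orthogonality of the characters of `ℤ/L` leaves only bond pairs in the
same class `2x₁ + e₁ ≡ 2x₁' + e₁'`, at most `10L` per class, whence the SUM RULE
`Σ_{J ∈ ℤ/L} Re⟨ψ, W_J Δ_dᴴΔ_d W_Jᴴ ψ⟩ ≤ 100·L⁴` for every unit vector `ψ`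
(`sum_re_expect_twist_pairPenalty_le`): at most `100/a` of the `L` twists of a state can keep
`d`-wave LRO density `≥ a`.

Lieb–Schultz–Mattis, Ann. Phys. 16 (1961) 407; M. Oshikawa, PRL 84 (2000) 1535 (momentum counting
of twisted states); H. Tasaki, J. Stat. Phys. 170 (2018) 653, §3. Elementary finite Fourier
analysis on `ℤ/L`; no definitions are introduced.
-/

set_option linter.dupNamespace false

noncomputable section

namespace Summit.HubbardSuperconductivity.HubbardSuperconductivity.Theorems.DeformationLadder

open Matrix Finset Literature.MathematicalPhysics.QuantumLattice Literature.Probability.LatticeModels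
open scoped Matrix.Norms.L2Operator ComplexOrder ComplexConjugate

/-! ### Abstract ingredients -/

section Abstract

variable {n : Type*} [Fintype n]

/-- Expansion of a Gram expectation: `⟨ψ, (Σ c_b π_b)ᴴ (Σ c_b π_b) ψ⟩ = Σ_{b,b'} conj(c_b) c_{b'} ⟨π_b ψ, π_{b'} ψ⟩`.
[folklore] -/
theorem tc_star_dotProduct_gram_sum_smul {ι : Type*} (B : Finset ι) (c : ι → ℂ)
    (π : ι → Matrix n n ℂ) (ψ : n → ℂ) :
    star ψ ⬝ᵥ (((∑ b ∈ B, c b • π b)ᴴ * ∑ b ∈ B, c b • π b) *ᵥ ψ) =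
      ∑ b ∈ B, ∑ b' ∈ B, conj (c b) * c b' * (star (π b *ᵥ ψ) ⬝ᵥ (π b' *ᵥ ψ)) := by
  rw [← mulVec_mulVec, dotProduct_mulVec, ← star_mulVec]
  have hA : (∑ b ∈ B, c b • π b) *ᵥ ψ = ∑ b ∈ B, c b • (π b *ᵥ ψ) := by
    rw [Matrix.sum_mulVec]
    exact Finset.sum_congr rfl fun b _ => smul_mulVec _ _ _
  rw [hA, star_sum, sum_dotProduct]
  refine Finset.sum_congr rfl fun b _ => ?_
  rw [dotProduct_sum]
  refine Finset.sum_congr rfl fun b' _ => ?_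
  rw [star_smul, smul_dotProduct, dotProduct_smul, smul_eq_mul, smul_eq_mul, Complex.star_def]
  ring

variable (L : ℕ) [NeZero L]

/-- **Orthogonality of the characters of `ℤ/L`**: `Σ_{J ∈ ℤ/L} e^{2πi J a/L} = L·[a = 0]`.
[folklore] -/
theorem tc_sum_toCircle_mul (a : ZMod L) :
    ∑ J : ZMod L, ((ZMod.toCircle (J * a) : Circle) : ℂ) = if a = 0 then (L : ℂ) else 0 := by
  have h := AddChar.sum_mulShift a (ZMod.isPrimitive_stdAddChar L)
  simp only [ZMod.stdAddChar_apply, ZMod.card] at h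
  rw [h]
  split_ifs <;> simp

/-- The character-weighted coefficients of the twisted pair field combine, after the sum over the
twists, into the class indicator: for real weights `w, w'` and classes `s, s' ∈ ℤ/L`,
`Σ_J conj(w conj χ(Js)) (w' conj χ(Js')) = w w' L [s = s']`. [folklore] -/
theorem tc_sum_coeff (w w' : ℝ) (s s' : ZMod L) :
    ∑ J : ZMod L, conj ((w : ℂ) * conj ((ZMod.toCircle (J * s) : Circle) : ℂ)) *
        ((w' : ℂ) * conj ((ZMod.toCircle (J * s') : Circle) : ℂ)) =
      if s = s' then ((w * w' * L : ℝ) : ℂ) else 0 := by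
  have hterm : ∀ J : ZMod L, conj ((w : ℂ) * conj ((ZMod.toCircle (J * s) : Circle) : ℂ)) *
      ((w' : ℂ) * conj ((ZMod.toCircle (J * s') : Circle) : ℂ)) =
      ((w * w' : ℝ) : ℂ) * ((ZMod.toCircle (J * (s - s')) : Circle) : ℂ) := by
    intro J
    rw [map_mul, Complex.conj_conj, Complex.conj_ofReal, ← Circle.coe_inv_eq_conj,
      ← AddChar.map_neg_eq_inv, mul_sub, sub_eq_add_neg, ← mul_neg, AddChar.map_add_eq_mul,
      Circle.coe_mul]
    push_cast
    ring
  simp_rw [hterm]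
  rw [← Finset.mul_sum, tc_sum_toCircle_mul]
  split_ifs with h h' h'
  · push_cast; ring
  · exact absurd (sub_eq_zero.1 h) h'
  · exact absurd (sub_eq_zero.2 h') h
  · rw [mul_zero]

/-- **Abstract sum rule.** For a finite family of vectors `v_b` (`‖v_b‖ ≤ V`), real weights
`|w_b| ≤ w₀` and classes `s_b ∈ ℤ/L`, the character-twisted Gram sums satisfy
`Σ_J Re Σ_{b,b'} conj(w_b conj χ(J s_b)) (w_{b'} conj χ(J s_{b'})) ⟨v_b, v_{b'}⟩ ≤ L w₀² V² #{(b,b') : s_b = s_{b'}}`.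
[folklore] -/
theorem tc_abstract_sumRule {ι : Type*} (B : Finset ι) (s : ι → ZMod L) (w : ι → ℝ)
    (v : ι → n → ℂ) {w₀ V : ℝ} (hw₀ : 0 ≤ w₀) (hV : 0 ≤ V) (hw : ∀ b ∈ B, |w b| ≤ w₀)
    (hv : ∀ b ∈ B, eucNorm (v b) ≤ V) :
    ∑ J : ZMod L, (∑ b ∈ B, ∑ b' ∈ B,
        conj ((w b : ℂ) * conj ((ZMod.toCircle (J * s b) : Circle) : ℂ)) *
          ((w b' : ℂ) * conj ((ZMod.toCircle (J * s b') : Circle) : ℂ)) *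
          (star (v b) ⬝ᵥ v b')).re ≤
      L * (w₀ ^ 2 * V ^ 2) * ((B ×ˢ B).filter fun p => s p.1 = s p.2).card := by
  -- perform the sum over `J` first
  rw [← Complex.re_sum, Finset.sum_comm]
  simp_rw [Finset.sum_comm (s := (Finset.univ : Finset (ZMod L))), ← Finset.sum_mul, tc_sum_coeff]
  -- bound term by term
  rw [Complex.re_sum, Finset.card_filter, Finset.sum_product, Nat.cast_sum, Finset.mul_sum]
  refine Finset.sum_le_sum fun b hb => ?_
  rw [Complex.re_sum, Nat.cast_sum, Finset.mul_sum]
  refine Finset.sum_le_sum fun b' hb' => ?_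
  split_ifs with hss
  · refine (Complex.re_le_norm _).trans ?_
    rw [norm_mul, Complex.norm_real, Real.norm_eq_abs, Nat.cast_one, mul_one]
    have h1 : |w b * w b' * L| ≤ w₀ ^ 2 * L := by
      rw [abs_mul, abs_mul, Nat.abs_cast]
      have := mul_le_mul (hw b hb) (hw b' hb') (abs_nonneg _) hw₀
      nlinarith [this, (Nat.cast_nonneg L : (0 : ℝ) ≤ L)]
    have h2 : ‖star (v b) ⬝ᵥ v b'‖ ≤ V ^ 2 := by
      refine (norm_star_dotProduct_le _ _).trans ?_
      rw [sq]
      exact mul_le_mul (hv b hb) (hv b' hb') (eucNorm_nonneg _) hV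
    calc |w b * w b' * L| * ‖star (v b) ⬝ᵥ v b'‖ ≤ (w₀ ^ 2 * L) * V ^ 2 :=
          mul_le_mul h1 h2 (norm_nonneg _) (by positivity)
      _ = L * (w₀ ^ 2 * V ^ 2) := by ring
  · simp

/-- Counting pairs in equal classes by fibres: if every class has at most `K` members in `B`, then
`#{(b,b') ∈ B × B : s_b = s_{b'}} ≤ #B · K`. [folklore] -/
theorem tc_card_filter_prod_le {ι κ : Type*} [DecidableEq κ] (B : Finset ι) (s : ι → κ) (K : ℕ)
    (hK : ∀ c : κ, (B.filter fun b => s b = c).card ≤ K) :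
    ((B ×ˢ B).filter fun p => s p.1 = s p.2).card ≤ B.card * K := by
  rw [Finset.card_filter, Finset.sum_product]
  have h : ∀ b ∈ B, (∑ b' ∈ B, if s b = s b' then 1 else 0) ≤ K := by
    intro b _
    have := hK (s b)
    rw [Finset.card_filter] at this
    refine le_trans (le_of_eq ?_) this
    exact Finset.sum_congr rfl fun b' _ => by simp only [eq_comm]
  exact (Finset.sum_le_card_nsmul _ _ _ h).trans (by rw [smul_eq_mul])

/-- In `ℤ/L` the equation `u + u = d` has at most two solutions. [folklore] -/
theorem tc_card_filter_add_self_le (d : ZMod L) :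
    ((Finset.univ : Finset (ZMod L)).filter fun u => u + u = d).card ≤ 2 := by
  by_contra hlt
  rw [not_le, Finset.two_lt_card_iff] at hlt
  obtain ⟨a, b, c, ha, hb, hc, hab, hac, hbc⟩ := hlt
  simp only [Finset.mem_filter, Finset.mem_univ, true_and] at ha hb hc
  -- a nonzero `v` with `v + v = 0` has `2 v.val = L`
  have key : ∀ v : ZMod L, v ≠ 0 → v + v = 0 → 2 * v.val = L := by
    intro v hv hvv
    have h1 : (v + v).val = 0 := by rw [hvv, ZMod.val_zero]
    rw [ZMod.val_add] at h1
    have h2 : 0 < v.val := Nat.pos_of_ne_zero fun h => hv ((ZMod.val_eq_zero v).1 h)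
    have h3 := ZMod.val_lt v
    have h4 := Nat.dvd_of_mod_eq_zero h1
    obtain ⟨k, hk⟩ := h4
    have hL : 0 < L := Nat.pos_of_ne_zero (NeZero.ne L)
    have hk1 : k < 2 := by nlinarith
    interval_cases k <;> omega
  have hvab : a - b ≠ 0 := sub_ne_zero.2 hab
  have hvac : a - c ≠ 0 := sub_ne_zero.2 hac
  have e1 : (a - b) + (a - b) = 0 := by
    have : (a + a) - (b + b) = 0 := by rw [ha, hb, sub_self]
    rw [← this]; ring
  have e2 : (a - c) + (a - c) = 0 := by
    have : (a + a) - (c + c) = 0 := by rw [ha, hc, sub_self]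
    rw [← this]; ring
  have h1 := key _ hvab e1
  have h2 := key _ hvac e2
  have : a - b = a - c := ZMod.val_injective L (by omega)
  exact hbc (by simpa using this)

/-- On the two-dimensional torus, at most `2L` sites `x` satisfy `x₁ + x₁ = d`. [folklore] -/
theorem tc_card_filter_torusSite_le (d : ZMod L) :
    ((Finset.univ : Finset (TorusSite 2 L)).filter fun x => x 0 + x 0 = d).card ≤ 2 * L := by
  classical
  set f : TorusSite 2 L → ZMod L × ZMod L := fun x => (x 0, x 1) with hf
  have hinj : Function.Injective f := by
    intro x y h
    simp only [hf, Prod.mk.injEq] at h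
    funext i
    fin_cases i
    · exact h.1
    · exact h.2
  have hsub : ((Finset.univ : Finset (TorusSite 2 L)).filter fun x => x 0 + x 0 = d).image f ⊆
      ((Finset.univ : Finset (ZMod L)).filter fun u => u + u = d) ×ˢ (Finset.univ : Finset (ZMod L)) := by
    intro p hp
    obtain ⟨x, hx, rfl⟩ := Finset.mem_image.1 hp
    simp only [Finset.mem_filter, Finset.mem_univ, true_and] at hx
    simp [hf, hx]
  calc ((Finset.univ : Finset (TorusSite 2 L)).filter fun x => x 0 + x 0 = d).card
      = (((Finset.univ : Finset (TorusSite 2 L)).filter fun x => x 0 + x 0 = d).image f).card :=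
        (Finset.card_image_of_injective _ hinj).symm
    _ ≤ (((Finset.univ : Finset (ZMod L)).filter fun u => u + u = d) ×ˢ
          (Finset.univ : Finset (ZMod L))).card := Finset.card_le_card hsub
    _ ≤ 2 * L := by
        rw [Finset.card_product, Finset.card_univ, ZMod.card]
        exact Nat.mul_le_mul_right L (tc_card_filter_add_self_le L d)

/-- A bond singlet pair applied to a unit vector has norm `≤ 2` (two products of two
contractions `‖c‖ ≤ 1`). [folklore] -/
theorem tc_eucNorm_bondPair_mulVec_le {Λ : Type*} [LinearOrder Λ] [Fintype Λ] {ψ : Fock (Orb Λ)}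
    (hψ : star ψ ⬝ᵥ ψ = 1) (p q : Λ) :
    eucNorm ((annihilation (orb p 0) * annihilation (orb q 1) -
        annihilation (orb p 1) * annihilation (orb q 0)) *ᵥ ψ) ≤ 2 := by
  have h1 : ∀ σ τ : Fin 2, eucNorm ((annihilation (orb p σ) * annihilation (orb q τ)) *ᵥ ψ) ≤ 1 := by
    intro σ τ
    refine (eucNorm_mulVec_le _ _).trans ?_
    rw [eucNorm_eq_one hψ, mul_one]
    exact (l2_opNorm_mul _ _).trans
      (mul_le_one₀ (norm_annihilation_le_one _) (norm_nonneg _) (norm_annihilation_le_one _))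
  rw [sub_mulVec]
  refine (eucNorm_sub_le _ _).trans ?_
  linarith [h1 0 1, h1 1 0]

end Abstract

/-! ### The twisted pair field and the sum rule on the torus -/

section Torus

variable (L : ℕ) [NeZero L]

/-- `|d(e)| ≤ 1` for the `d_{x²-y²}` form factor. [folklore] -/
theorem tc_abs_dWaveFormFactor_le (e : Site 2) : |dWaveFormFactor e| ≤ 1 := by
  unfold dWaveFormFactor
  split_ifs <;> norm_num

/-- `{0, ±e₁, ±e₂}` has at most five elements. [folklore] -/
theorem tc_card_insert_unitSteps_le : (insert (0 : Site 2) unitSteps).card ≤ 5 := by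
  refine (Finset.card_insert_le _ _).trans ?_
  have : unitSteps.card ≤ 4 := Finset.card_le_four
  omega

/-- Two conjugate characters multiply to the conjugate character of the sum. [folklore] -/
theorem tc_conj_toCircle_mul_conj_toCircle (a b : ZMod L) :
    conj ((ZMod.toCircle a : Circle) : ℂ) * conj ((ZMod.toCircle b : Circle) : ℂ) =
      conj ((ZMod.toCircle (a + b) : Circle) : ℂ) := by
  rw [← map_mul, ← Circle.coe_mul, ← AddChar.map_add_eq_mul]

/-- **The twisted pair field.** Conjugation by the charge twist `W_J = phaseGauge (z ↦ e^{2πiJz₁/L})`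
multiplies the bond pair at `(x, x+e)` of the pair field `Δ_φ = Σ_x Σ_e (φ(e)/√2)(c_{x↑}c_{x+e,↓} − c_{x↓}c_{x+e,↑})`
by `e^{-2πi J (x₁ + (x+e)₁)/L}` — the pair field at pair momentum `4πJ/L` along `e₁`.
Lieb–Schultz–Mattis (1961); Tasaki, J. Stat. Phys. 170 (2018) 653, §3. [cite: Watanabe2019, §2.2.3] -/
theorem twist_conj_pairField (φ : Site 2 → ℝ) (J : ZMod L) :
    phaseGauge (fun z : FermionTorus 2 L => ZMod.toCircle (J * z.toTorusSite 0)) * pairField φ L *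
        (phaseGauge (fun z : FermionTorus 2 L => ZMod.toCircle (J * z.toTorusSite 0)))ᴴ =
      ∑ x : TorusSite 2 L, ∑ e ∈ insert (0 : Site 2) unitSteps,
        (((φ e / Real.sqrt 2 : ℝ) : ℂ) *
            conj ((ZMod.toCircle (J * (x 0 + (x + Torus.proj L e) 0)) : Circle) : ℂ)) •
          (annihilation (orb (FermionTorus.ofTorusSite x) 0) *
              annihilation (orb (FermionTorus.ofTorusSite (x + Torus.proj L e)) 1) -
            annihilation (orb (FermionTorus.ofTorusSite x) 1) *
              annihilation (orb (FermionTorus.ofTorusSite (x + Torus.proj L e)) 0)) := by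
  set W := phaseGauge (fun z : FermionTorus 2 L => ZMod.toCircle (J * z.toTorusSite 0)) with hW
  have hpair : ∀ (y y' : TorusSite 2 L) (σ τ : Fin 2),
      W * (annihilation (orb (FermionTorus.ofTorusSite y) σ) *
        annihilation (orb (FermionTorus.ofTorusSite y') τ)) * Wᴴ =
        conj ((ZMod.toCircle (J * (y 0 + y' 0)) : Circle) : ℂ) •
          (annihilation (orb (FermionTorus.ofTorusSite y) σ) *
            annihilation (orb (FermionTorus.ofTorusSite y') τ)) := by
    intro y y' σ τ
    rw [hW, phaseGauge_mul_mul_mul_conjTranspose, phaseGauge_mul_annihilation_mul_conjTranspose,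
      phaseGauge_mul_annihilation_mul_conjTranspose, smul_mul_smul_comm]
    simp only [FermionTorus.toTorusSite_ofTorusSite]
    rw [tc_conj_toCircle_mul_conj_toCircle, mul_add]
  unfold pairField localPair
  simp only [Finset.mul_sum, Finset.sum_mul, Matrix.mul_smul, Matrix.smul_mul, Matrix.mul_sub,
    Matrix.sub_mul, hpair]
  refine Finset.sum_congr rfl fun x _ => Finset.sum_congr rfl fun e _ => ?_
  rw [← smul_sub, smul_smul]

/-- **The pair-momentum sum rule (Parseval over the charge twists).** For every unit vector `ψ`
of the Hubbard torus, the `d`-wave pair weights of its `L` charge twists add up to at most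
`100·L⁴`:  `Σ_{J ∈ ℤ/L} Re⟨ψ, W_J Δ_dᴴΔ_d W_Jᴴ ψ⟩ ≤ 100·L⁴`.
(Orthogonality of characters: only bond pairs with `2x₁+e₁ ≡ 2x₁'+e₁'` survive the sum over `J`;
each such class has `≤ 10L` bonds, there are `≤ 5L²` bonds, `|d(e)/√2|² ≤ 1/2` and
`‖(c c − c c)ψ‖ ≤ 2`.) Oshikawa, PRL 84 (2000) 1535; Tasaki, J. Stat. Phys. 170 (2018) 653, §3.
[cite: Watanabe2019, §2.2.3] -/
theorem sum_re_expect_twist_pairPenalty_le {ψ : Fock (Orb (FermionTorus 2 L))}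
    (hψ : star ψ ⬝ᵥ ψ = 1) :
    ∑ J : ZMod L, (expect
        (phaseGauge (fun z : FermionTorus 2 L => ZMod.toCircle (J * z.toTorusSite 0)) *
          ((pairField dWaveFormFactor L)ᴴ * pairField dWaveFormFactor L) *
          (phaseGauge (fun z : FermionTorus 2 L => ZMod.toCircle (J * z.toTorusSite 0)))ᴴ) ψ).re ≤
      100 * (L : ℝ) ^ 4 := by
  classical
  -- the bonds `b = (x, e)`, their classes, weights and pair vectors
  set B : Finset (TorusSite 2 L × Site 2) := Finset.univ ×ˢ insert (0 : Site 2) unitSteps with hB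
  set s : TorusSite 2 L × Site 2 → ZMod L := fun b => b.1 0 + (b.1 + Torus.proj L b.2) 0 with hs
  set w : TorusSite 2 L × Site 2 → ℝ := fun b => dWaveFormFactor b.2 / Real.sqrt 2 with hw
  set π : TorusSite 2 L × Site 2 → Matrix (Finset (Orb (FermionTorus 2 L)))
      (Finset (Orb (FermionTorus 2 L))) ℂ := fun b =>
    annihilation (orb (FermionTorus.ofTorusSite b.1) 0) *
        annihilation (orb (FermionTorus.ofTorusSite (b.1 + Torus.proj L b.2)) 1) -
      annihilation (orb (FermionTorus.ofTorusSite b.1) 1) *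
        annihilation (orb (FermionTorus.ofTorusSite (b.1 + Torus.proj L b.2)) 0) with hπ
  -- the twisted penalty is the Gram matrix of the twisted pair field
  have hQ : ∀ J : ZMod L,
      phaseGauge (fun z : FermionTorus 2 L => ZMod.toCircle (J * z.toTorusSite 0)) *
          ((pairField dWaveFormFactor L)ᴴ * pairField dWaveFormFactor L) *
          (phaseGauge (fun z : FermionTorus 2 L => ZMod.toCircle (J * z.toTorusSite 0)))ᴴ =
        (∑ b ∈ B, ((w b : ℂ) * conj ((ZMod.toCircle (J * s b) : Circle) : ℂ)) • π b)ᴴ *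
          ∑ b ∈ B, ((w b : ℂ) * conj ((ZMod.toCircle (J * s b) : Circle) : ℂ)) • π b := by
    intro J
    rw [phaseGauge_mul_mul_mul_conjTranspose, phaseGauge_mul_conjTranspose_mul_conjTranspose,
      twist_conj_pairField, hB, Finset.sum_product]
  have hexp : ∀ J : ZMod L, expect
      (phaseGauge (fun z : FermionTorus 2 L => ZMod.toCircle (J * z.toTorusSite 0)) *
        ((pairField dWaveFormFactor L)ᴴ * pairField dWaveFormFactor L) *
        (phaseGauge (fun z : FermionTorus 2 L => ZMod.toCircle (J * z.toTorusSite 0)))ᴴ) ψ =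
      ∑ b ∈ B, ∑ b' ∈ B, conj ((w b : ℂ) * conj ((ZMod.toCircle (J * s b) : Circle) : ℂ)) *
        ((w b' : ℂ) * conj ((ZMod.toCircle (J * s b') : Circle) : ℂ)) *
        (star (π b *ᵥ ψ) ⬝ᵥ (π b' *ᵥ ψ)) := by
    intro J
    rw [hQ J, Literature.MathematicalPhysics.QuantumLattice.expect, tc_star_dotProduct_gram_sum_smul]
  simp_rw [hexp]
  -- the abstract sum rule with `w₀ = 1/√2`, `V = 2`
  have hw0 : (0 : ℝ) ≤ 1 / Real.sqrt 2 := by positivity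
  have hwb : ∀ b ∈ B, |w b| ≤ 1 / Real.sqrt 2 := by
    intro b _
    rw [hw]
    simp only
    rw [abs_div, abs_of_pos (Real.sqrt_pos.2 (by norm_num : (0 : ℝ) < 2))]
    exact div_le_div_of_nonneg_right (tc_abs_dWaveFormFactor_le b.2) (Real.sqrt_nonneg 2)
  have hvb : ∀ b ∈ B, eucNorm (π b *ᵥ ψ) ≤ 2 := fun b _ => tc_eucNorm_bondPair_mulVec_le hψ _ _
  refine (tc_abstract_sumRule L B s w (fun b => π b *ᵥ ψ) hw0 zero_le_two hwb hvb).trans ?_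
  -- counting: every class meets at most `10 L` bonds, and there are at most `5 L²` bonds
  have hfib : ∀ c : ZMod L, (B.filter fun b => s b = c).card ≤ 10 * L := by
    intro c
    rw [hB, Finset.card_filter, Finset.sum_product, Finset.sum_comm]
    have hstep : ∀ e ∈ insert (0 : Site 2) unitSteps,
        (∑ x : TorusSite 2 L, if s (x, e) = c then 1 else 0) ≤ 2 * L := by
      intro e _
      rw [← Finset.card_filter]
      have hset : (Finset.univ.filter fun x : TorusSite 2 L => s (x, e) = c) =
          Finset.univ.filter fun x : TorusSite 2 L => x 0 + x 0 = c - (Torus.proj L e) 0 := by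
        refine Finset.filter_congr fun x _ => ?_
        rw [hs]
        simp only [Pi.add_apply]
        rw [eq_sub_iff_add_eq, add_assoc]
      rw [hset]
      exact tc_card_filter_torusSite_le L _
    calc ∑ e ∈ insert (0 : Site 2) unitSteps, ∑ x : TorusSite 2 L, (if s (x, e) = c then 1 else 0)
        ≤ ∑ _e ∈ insert (0 : Site 2) unitSteps, 2 * L := Finset.sum_le_sum hstep
      _ = (insert (0 : Site 2) unitSteps).card * (2 * L) := by rw [Finset.sum_const, smul_eq_mul]
      _ ≤ 5 * (2 * L) := Nat.mul_le_mul_right _ (tc_card_insert_unitSteps_le)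
      _ = 10 * L := by ring
  have hcardB : B.card ≤ 5 * L ^ 2 := by
    rw [hB, Finset.card_product, Finset.card_univ, Fintype.card_pi, Finset.prod_const,
      Finset.card_univ, Fintype.card_fin, ZMod.card, mul_comm]
    exact Nat.mul_le_mul_right _ (tc_card_insert_unitSteps_le)
  have hpairs : (((B ×ˢ B).filter fun p => s p.1 = s p.2).card : ℝ) ≤ 5 * (L : ℝ) ^ 2 * (10 * L) := by
    have h := tc_card_filter_prod_le B s (10 * L) hfib
    have h' : B.card * (10 * L) ≤ 5 * L ^ 2 * (10 * L) := Nat.mul_le_mul_right _ hcardB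
    exact_mod_cast h.trans h'
  have hconst : (1 / Real.sqrt 2) ^ 2 * (2 : ℝ) ^ 2 = 2 := by
    rw [div_pow, one_pow, Real.sq_sqrt zero_le_two]; norm_num
  rw [hconst]
  have hL : (0 : ℝ) ≤ L := Nat.cast_nonneg L
  calc (L : ℝ) * 2 * (((B ×ˢ B).filter fun p => s p.1 = s p.2).card : ℝ)
      ≤ (L : ℝ) * 2 * (5 * (L : ℝ) ^ 2 * (10 * L)) := by
        exact mul_le_mul_of_nonneg_left hpairs (by positivity)
    _ = 100 * (L : ℝ) ^ 4 := by ring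

end Torus

end Summit.HubbardSuperconductivity.HubbardSuperconductivity.Theorems.DeformationLadder
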